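import Literature.Analysis.SingularIntegrals.Marcinkiewicz
import Literature.Analysis.SingularIntegrals.CalderonZygmundDecomposition
import Mathlib.MeasureTheory.Function.LpSeminorm.ChebyshevMarkov
import Mathlib.MeasureTheory.Integral.Prod
import Mathlib.MeasureTheory.Group.LIntegral
import Mathlib.MeasureTheory.Integral.DominatedConvergence
import Mathlib.Analysis.Normed.Group.InfiniteSum
import HarnessLib

/-!
# Singular integrals are of weak type (1,1) (Stein 1970, Ch. II §2.4 and §3.1 Corollary)

Analysis/SingularIntegrals file 3 of the Calderón–Zygmund `L^p` theory vendored for the discharge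
of `Literature.Analysis.FluidPDE.stein1970_normalisedPressure_Lp_bound` (Stein 1970, Ch. II
§4.2 Theorem 3). Everything here is PROVED.

**Stein 1970, Ch. II §2.2 Theorem 1, second step (§2.4) in the variant of §3.1 (Corollary:
Hörmander's condition (2')).** *Let `K` be a kernel with `‖K * f‖₂ ≤ A‖f‖₂` and
`∫_{|x| ≥ 2|y|} |K(x-y) - K(x)| dx ≤ B` (`|y| > 0`). Then `T f = K * f` is of weak type `(1,1)`:
`m{|Tf| > α} ≤ (C/α) ‖f‖₁` with `C` depending only on `A`, `B` and the dimension.* Printed proof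
(§2.4.1–2.4.3 with the changes of §3.1): Calderón–Zygmund decomposition `f = g + Σ b_j` at height
`α`; `‖g‖₂² ≤ Cα‖f‖₁` and the `L²` bound give `m{|Tg| > α/2} ≤ (C/α)‖f‖₁` ((12)); for the bad part,
`Tb_j(x) = ∫ [K(x-y) - K(x-y^j)] b_j(y) dy` off the doubled piece `Q_j*` (mean zero), so by (2')
`∫_{F*} |Tb| ≤ Σ_j ∫_{x∉Q_j*}∫_{Q_j} |K(x-y)-K(x-y^j)||b(y)| ≤ B' Σ‖b_j‖₁ ≤ C‖f‖₁` ((17)), while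
`m(⋃ Q_j*) ≤ (C/α)‖f‖₁`; Chebyshev finishes ((15)–(16)).

## Rendering (design notes)

* `E` is a finite-dimensional real normed space (`n = dim E ≥ 1`) with an additive Haar measure
  `μ`; the kernel `k : E → ℝ` is measurable and bounded (the qualitative standing assumption that
  makes `Tf(x) = ∫ f(t) k(x-t) dμ(t)` an absolutely convergent integral for `f ∈ L¹`; Stein's
  `K ∈ L²` plays the same role, cf. his remark after Theorem 1 — the bound never enters the
  constants). The operator is written out as `x ↦ ∫ t, f t * k (x - t) ∂μ` (no new definition).
* The admissible class is **bounded, compactly supported, measurable** `f` (dense in every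
  `L^p`, stable under the cuts of the Marcinkiewicz theorem and under the Calderón–Zygmund
  splitting); the `L²` hypothesis is assumed on this class (file 4 derives it from continuous
  compactly supported `f` by density).
* Hörmander's condition is `∫⁻_{2‖y‖ ≤ ‖x‖} ‖k(x-y) - k(x)‖ₑ dμ ≤ B` for all `y`.
* Conclusion (`weakType_one_one`): `s · μ{s < |Tf|} ≤ (4ⁿ⁺¹A² + 8ⁿ + 4B) ‖f‖₁` for `s > 0`, in
  `ℝ≥0∞` (the pieces of file 2 are balls `B̄(cᵢ,4rᵢ)`, doubled to `B̄(cᵢ,8rᵢ)`).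

## Mathlib / tree

`MeasureTheory.integral_tsum`, `enorm_integral_le_lintegral_enorm`, `lintegral_lintegral_swap`,
`lintegral_sub_right_eq_self`, `mul_meas_ge_le_pow_eLpNorm'`, `mul_meas_ge_le_lintegral₀`
(used); tree: `exists_calderonZygmund_decomposition` (file 2).

## References

* E. M. Stein, *Singular integrals and differentiability properties of functions*, Princeton
  Math. Series 30 (1970): Ch. II §2.2 Theorem 1, §2.4 (proof, (9)–(16)), §3.1 Corollary and
  (2'), (17). [`Stein1971`]
* L. Hörmander, *Estimates for translation invariant operators in `L^p` spaces*, Acta Math. 104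
  (1960) 93–140 (condition (2')).
-/

noncomputable section

open MeasureTheory Metric Set Filter Function
open scoped ENNReal NNReal Topology

namespace Literature.Analysis.SingularIntegrals

universe u

variable {E : Type u} [NormedAddCommGroup E] [NormedSpace ℝ E] [FiniteDimensional ℝ E]
  [MeasurableSpace E] [BorelSpace E] {μ : Measure E} [μ.IsAddHaarMeasure]

/-! ### The convolution operator with a bounded measurable kernel -/

section Kernel

variable {k : E → ℝ} {M : ℝ}

omit [μ.IsAddHaarMeasure] in
/-- The integrand `t ↦ f(t) k(x-t)` is integrable for `f ∈ L¹` and `k` bounded measurable. [folklore] -/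
theorem integrable_mul_kernel (hk : Measurable k) (hM : ∀ x, |k x| ≤ M) {f : E → ℝ}
    (hf : Integrable f μ) (x : E) : Integrable (fun t => f t * k (x - t)) μ :=
  hf.mul_bdd (hk.comp (measurable_const.sub measurable_id)).aestronglyMeasurable
    (Eventually.of_forall fun t => by rw [Real.norm_eq_abs]; exact hM (x - t))

omit [NormedSpace ℝ E] [FiniteDimensional ℝ E] [BorelSpace E] [μ.IsAddHaarMeasure] in
/-- `|∫ f(t) k(x-t) dt| ≤ M ‖f‖₁`. [folklore] -/
theorem abs_integral_mul_kernel_le (hM : ∀ x, |k x| ≤ M) {f : E → ℝ} (hf : Integrable f μ) (x : E) :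
    |∫ t, f t * k (x - t) ∂μ| ≤ M * ∫ t, |f t| ∂μ := by
  have hM0 : 0 ≤ M := (abs_nonneg _).trans (hM 0)
  calc |∫ t, f t * k (x - t) ∂μ| ≤ ∫ t, M * |f t| ∂μ := by
        rw [← Real.norm_eq_abs]
        refine norm_integral_le_of_norm_le (hf.abs.const_mul M) (Eventually.of_forall fun t => ?_)
        rw [Real.norm_eq_abs, abs_mul, mul_comm]
        exact mul_le_mul_of_nonneg_right (hM _) (abs_nonneg _)
    _ = M * ∫ t, |f t| ∂μ := integral_const_mul _ _

omit [μ.IsAddHaarMeasure] in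
/-- Joint measurability of `(x, t) ↦ f(t) k(x-t)`. [folklore] -/
theorem measurable_mul_kernel_uncurry (hk : Measurable k)
    {f : E → ℝ} (hf : Measurable f) :
    Measurable fun z : E × E => f z.2 * k (z.1 - z.2) :=
  (hf.comp measurable_snd).mul (hk.comp (measurable_fst.sub measurable_snd))

omit [μ.IsAddHaarMeasure] in
/-- `x ↦ ∫ f(t) k(x-t) dt` is strongly measurable. [folklore] -/
theorem stronglyMeasurable_integral_mul_kernel [SFinite μ] (hk : Measurable k) {f : E → ℝ}
    (hf : Measurable f) : StronglyMeasurable fun x => ∫ t, f t * k (x - t) ∂μ :=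
  (measurable_mul_kernel_uncurry hk hf).stronglyMeasurable.integral_prod_right'

omit [μ.IsAddHaarMeasure] in
/-- The operator `f ↦ ∫ f(t) k(· - t) dt` passes through a Calderón–Zygmund sum `f = Σ bᵢ`
(pointwise sum with `Σ ‖bᵢ‖₁ < ∞`). [folklore] -/
theorem integral_mul_kernel_eq_tsum {ι : Type*} [Countable ι] (hk : Measurable k) (hM : ∀ x, |k x| ≤ M)
    {b : ι → E → ℝ} (hbi : ∀ i, Integrable (b i) μ) (hsum : ∑' i, ∫⁻ t, ‖b i t‖ₑ ∂μ ≠ ⊤)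
    {F : E → ℝ} (hF : ∀ t, HasSum (fun i => b i t) (F t)) (x : E) :
    ∫ t, F t * k (x - t) ∂μ = ∑' i, ∫ t, b i t * k (x - t) ∂μ := by
  have h1 : (fun t => F t * k (x - t)) = fun t => ∑' i, b i t * k (x - t) := by
    funext t
    rw [tsum_mul_right, (hF t).tsum_eq]
  rw [h1]
  refine integral_tsum (fun i => (integrable_mul_kernel hk hM (hbi i) x).aestronglyMeasurable) ?_
  have hM0 : 0 ≤ M := (abs_nonneg _).trans (hM 0)
  have hle : ∀ i, ∫⁻ t, ‖b i t * k (x - t)‖ₑ ∂μ ≤ ENNReal.ofReal M * ∫⁻ t, ‖b i t‖ₑ ∂μ := by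
    intro i
    rw [← lintegral_const_mul' _ _ ENNReal.ofReal_ne_top]
    refine lintegral_mono fun t => ?_
    rw [enorm_mul, mul_comm]
    gcongr
    rw [Real.enorm_eq_ofReal_abs]
    exact ENNReal.ofReal_le_ofReal (hM _)
  refine ne_top_of_le_ne_top (ENNReal.mul_ne_top (ENNReal.ofReal_ne_top (r := M)) hsum) ?_
  calc ∑' i, ∫⁻ t, ‖b i t * k (x - t)‖ₑ ∂μ ≤ ∑' i, ENNReal.ofReal M * ∫⁻ t, ‖b i t‖ₑ ∂μ :=
        ENNReal.tsum_le_tsum hle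
    _ = ENNReal.ofReal M * ∑' i, ∫⁻ t, ‖b i t‖ₑ ∂μ := ENNReal.tsum_mul_left

/-- **The Hörmander estimate for one mean-zero piece** (Stein 1970, Ch. II §3.1, proof of the
Corollary, (17)): if `b` is supported in `B̄(c, 4r)` with `∫ b = 0` and
`∫_{2‖y‖≤‖x‖} |k(x-y) - k(x)| ≤ B`, then `∫_{x ∉ B̄(c,8r)} |∫ b(t)k(x-t)dt| dx ≤ B ‖b‖₁`
(write `k(x-t) - k(x-c)` using the mean zero, Tonelli, translate by `c`). [cite: Stein1971, Ch. II §3.1 (17)] -/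
theorem lintegral_compl_ball_integral_mul_kernel_le (hk : Measurable k) (hM : ∀ x, |k x| ≤ M) {B : ℝ≥0}
    (hH : ∀ y : E, ∫⁻ x in {x | 2 * ‖y‖ ≤ ‖x‖}, ‖k (x - y) - k x‖ₑ ∂μ ≤ B)
    {b : E → ℝ} (hbm : Measurable b) (hbi : Integrable b μ) {c : E} {r : ℝ}
    (hsupp : support b ⊆ closedBall c (4 * r)) (hmean : ∫ t, b t ∂μ = 0) :
    ∫⁻ x in (closedBall c (8 * r))ᶜ, ‖∫ t, b t * k (x - t) ∂μ‖ₑ ∂μ ≤ B * ∫⁻ t, ‖b t‖ₑ ∂μ := by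
  set S : Set E := (closedBall c (8 * r))ᶜ with hS
  -- use the mean zero of `b`
  have hsub : ∀ x, ∫ t, b t * k (x - t) ∂μ = ∫ t, b t * (k (x - t) - k (x - c)) ∂μ := by
    intro x
    have h2 : Integrable (fun t => b t * k (x - c)) μ := hbi.mul_const _
    rw [show (fun t => b t * (k (x - t) - k (x - c))) = fun t => b t * k (x - t) - b t * k (x - c) by
      funext t; ring]
    rw [integral_sub (integrable_mul_kernel hk hM hbi x) h2, integral_mul_const, hmean, zero_mul, sub_zero]
  have hpt : ∀ x, ‖∫ t, b t * k (x - t) ∂μ‖ₑ ≤ ∫⁻ t, ‖b t‖ₑ * ‖k (x - t) - k (x - c)‖ₑ ∂μ := by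
    intro x
    rw [hsub x]
    refine (enorm_integral_le_lintegral_enorm _).trans (le_of_eq (lintegral_congr fun t => ?_))
    exact enorm_mul _ _
  -- measurability of the joint integrand
  have hFm : Measurable fun z : E × E => ‖b z.2‖ₑ * ‖k (z.1 - z.2) - k (z.1 - c)‖ₑ :=
    (hbm.comp measurable_snd).enorm.mul
      ((hk.comp (measurable_fst.sub measurable_snd)).sub (hk.comp (measurable_fst.sub measurable_const))).enorm
  -- the inner integral is bounded by `B` on the support of `b`
  have hinner : ∀ t, ‖b t‖ₑ * ∫⁻ x in S, ‖k (x - t) - k (x - c)‖ₑ ∂μ ≤ ‖b t‖ₑ * B := by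
    intro t
    by_cases hbt : b t = 0
    · simp [hbt]
    have ht : ‖t - c‖ ≤ 4 * r := by
      rw [← dist_eq_norm]; exact mem_closedBall.1 (hsupp (mem_support.2 hbt))
    gcongr
    calc ∫⁻ x in S, ‖k (x - t) - k (x - c)‖ₑ ∂μ
        ≤ ∫⁻ x in {x | 2 * ‖t - c‖ ≤ ‖x - c‖}, ‖k (x - t) - k (x - c)‖ₑ ∂μ := by
          refine lintegral_mono_set fun x hx => ?_
          simp only [hS, mem_compl_iff, mem_closedBall, not_le, dist_eq_norm] at hx
          show 2 * ‖t - c‖ ≤ ‖x - c‖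
          linarith
      _ = ∫⁻ x, ({z : E | 2 * ‖t - c‖ ≤ ‖z‖}.indicator (fun z => ‖k (z - (t - c)) - k z‖ₑ)) (x - c) ∂μ := by
          have hSm : MeasurableSet {x : E | 2 * ‖t - c‖ ≤ ‖x - c‖} :=
            measurableSet_le measurable_const (measurable_sub_const c).norm
          rw [← lintegral_indicator hSm]
          refine lintegral_congr fun x => ?_
          simp only [indicator, mem_setOf_eq, sub_sub_sub_cancel_right]
      _ = ∫⁻ z, {z : E | 2 * ‖t - c‖ ≤ ‖z‖}.indicator (fun z => ‖k (z - (t - c)) - k z‖ₑ) z ∂μ :=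
          lintegral_sub_right_eq_self _ c
      _ = ∫⁻ z in {z : E | 2 * ‖t - c‖ ≤ ‖z‖}, ‖k (z - (t - c)) - k z‖ₑ ∂μ :=
          lintegral_indicator (measurableSet_le measurable_const measurable_norm) _
      _ ≤ B := hH (t - c)
  calc ∫⁻ x in S, ‖∫ t, b t * k (x - t) ∂μ‖ₑ ∂μ
      ≤ ∫⁻ x in S, ∫⁻ t, ‖b t‖ₑ * ‖k (x - t) - k (x - c)‖ₑ ∂μ ∂μ := lintegral_mono fun x => hpt x
    _ = ∫⁻ t, ∫⁻ x in S, ‖b t‖ₑ * ‖k (x - t) - k (x - c)‖ₑ ∂μ ∂μ :=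
        lintegral_lintegral_swap hFm.aemeasurable
    _ = ∫⁻ t, ‖b t‖ₑ * ∫⁻ x in S, ‖k (x - t) - k (x - c)‖ₑ ∂μ ∂μ := by
        refine lintegral_congr fun t => ?_
        rw [lintegral_const_mul' _ _ (enorm_ne_top (E := ℝ))]
    _ ≤ ∫⁻ t, ‖b t‖ₑ * B ∂μ := lintegral_mono fun t => hinner t
    _ = B * ∫⁻ t, ‖b t‖ₑ ∂μ := by rw [lintegral_mul_const _ hbm.enorm, mul_comm]

end Kernel

/-! ### Weak type (1,1) -/

omit [NormedSpace ℝ E] [FiniteDimensional ℝ E] [BorelSpace E] [μ.IsAddHaarMeasure] in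
/-- Bounded, compactly supported, (strongly) measurable functions are integrable. [folklore] -/
theorem integrable_of_bdd_of_hasCompactSupport [IsFiniteMeasureOnCompacts μ] {f : E → ℝ}
    (hf : Measurable f) {C : ℝ} (hC : ∀ x, |f x| ≤ C) (hfc : HasCompactSupport f) : Integrable f μ := by
  rw [← integrableOn_iff_integrable_of_support_subset (subset_tsupport f)]
  exact Measure.integrableOn_of_bounded hfc.isCompact.measure_lt_top.ne hf.aestronglyMeasurable
    (Eventually.of_forall fun x => by rw [Real.norm_eq_abs]; exact hC x)

/-- **Singular integrals are of weak type (1,1)** (Stein 1970, Ch. II §2.2 Theorem 1, §2.4, in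
the variant of §3.1, Corollary). Let `k` be a bounded measurable kernel on a finite-dimensional
real normed space `E` (`n = dim E ≥ 1`, additive Haar measure `μ`) such that
`Tf(x) = ∫ f(t) k(x-t) dμ(t)` satisfies `‖Tf‖₂ ≤ A‖f‖₂` for all bounded, compactly supported,
measurable `f`, and Hörmander's condition `∫_{2‖y‖≤‖x‖} |k(x-y) - k(x)| dμ(x) ≤ B` for all `y`.
Then for every bounded, compactly supported, measurable `f` and every `s > 0`,
`s · μ{s < |Tf|} ≤ (4ⁿ⁺¹ A² + 8ⁿ + 4B) ‖f‖₁`. [cite: Stein1971, Ch. II §3.1 Cor] -/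
theorem weakType_one_one [Nontrivial E] {k : E → ℝ} (hk : Measurable k) {M : ℝ} (hM : ∀ x, |k x| ≤ M)
    {A B : ℝ≥0}
    (hL2 : ∀ f : E → ℝ, Measurable f → (∃ C, ∀ x, |f x| ≤ C) → HasCompactSupport f →
      eLpNorm (fun x => ∫ t, f t * k (x - t) ∂μ) 2 μ ≤ A * eLpNorm f 2 μ)
    (hH : ∀ y : E, ∫⁻ x in {x | 2 * ‖y‖ ≤ ‖x‖}, ‖k (x - y) - k x‖ₑ ∂μ ≤ B)
    {f : E → ℝ} (hf : Measurable f) (hfb : ∃ C, ∀ x, |f x| ≤ C) (hfc : HasCompactSupport f)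
    {s : ℝ} (hs : 0 < s) :
    ENNReal.ofReal s * μ {x | s < |∫ t, f t * k (x - t) ∂μ|} ≤
      (4 ^ (Module.finrank ℝ E + 1) * (A : ℝ≥0∞) ^ 2 + 8 ^ Module.finrank ℝ E + 4 * B) *
        ∫⁻ x, ‖f x‖ₑ ∂μ := by
  set n : ℕ := Module.finrank ℝ E with hn
  obtain ⟨C, hC⟩ := hfb
  have hfi : Integrable f μ := integrable_of_bdd_of_hasCompactSupport hf hC hfc
  set L : ℝ≥0∞ := ∫⁻ x, ‖f x‖ₑ ∂μ with hL
  /- the Calderón–Zygmund decomposition at height `s` -/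
  obtain ⟨ι, _, c, r, g, b, hr, hballs, hgm, hgi, hg_ae, hg_bdd, hgL1, hg_cpt, hbm, hbi, hbsupp,
    hbmean, hbL1, hbsum⟩ := exists_calderonZygmund_decomposition μ hf hfi hs
  have hgc : HasCompactSupport g := hg_cpt hfc
  have hgb : ∃ C', ∀ x, |g x| ≤ C' := ⟨max C (4 ^ n * s), fun x => (hg_bdd x).trans (max_le_max (hC x) le_rfl)⟩
  /- the three operators -/
  set Tf : E → ℝ := fun x => ∫ t, f t * k (x - t) ∂μ with hTf
  set Tg : E → ℝ := fun x => ∫ t, g t * k (x - t) ∂μ with hTg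
  set Tb : E → ℝ := fun x => ∫ t, (f t - g t) * k (x - t) ∂μ with hTb
  set Tbi : ι → E → ℝ := fun i x => ∫ t, b i t * k (x - t) ∂μ with hTbi
  have hTf_eq : ∀ x, Tf x = Tg x + Tb x := by
    intro x
    have h1 : Integrable (fun t => g t * k (x - t)) μ := integrable_mul_kernel hk hM hgi x
    have h2 : Integrable (fun t => (f t - g t) * k (x - t)) μ := integrable_mul_kernel hk hM (hfi.sub hgi) x
    simp only [hTf, hTg, hTb]
    rw [← integral_add h1 h2]
    exact integral_congr_ae (Eventually.of_forall fun t => by ring)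
  have hTb_tsum : ∀ x, Tb x = ∑' i, Tbi i x := fun x =>
    integral_mul_kernel_eq_tsum hk hM hbi
      (ne_top_of_le_ne_top (ENNReal.mul_ne_top (by norm_num) hfi.2.ne) hbL1) hbsum x
  have hTg_meas : AEStronglyMeasurable Tg μ := (stronglyMeasurable_integral_mul_kernel hk hgm).aestronglyMeasurable
  have hTb_meas : Measurable Tb := (stronglyMeasurable_integral_mul_kernel hk (hf.sub hgm)).measurable
  have hTbi_meas : ∀ i, Measurable (Tbi i) := fun i => (stronglyMeasurable_integral_mul_kernel hk (hbm i)).measurable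
  /- Step 1: the level set splits -/
  have hsplit : μ {x | s < |Tf x|} ≤ μ {x | s / 2 < |Tg x|} + μ {x | s / 2 < |Tb x|} := by
    calc μ {x | s < |Tf x|} ≤ μ ({x | s / 2 < |Tg x|} ∪ {x | s / 2 < |Tb x|}) := by
          refine measure_mono fun x (hx : s < |Tf x|) => ?_
          rw [hTf_eq x] at hx
          rw [mem_union, mem_setOf_eq, mem_setOf_eq]
          by_contra hcon
          rw [not_or, not_lt, not_lt] at hcon
          linarith [hcon.1, hcon.2, abs_add_le (Tg x) (Tb x)]
      _ ≤ _ := measure_union_le _ _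
  /- Step 2: the good part, `s μ{s/2 < |Tg|} ≤ 4ⁿ⁺¹ A² ‖f‖₁` -/
  have hgood : ENNReal.ofReal s * μ {x | s / 2 < |Tg x|} ≤ 4 ^ (n + 1) * (A : ℝ≥0∞) ^ 2 * L := by
    have hs2 : 0 < s / 2 := by positivity
    -- Chebyshev in `L²`
    have hcheb : ENNReal.ofReal (s / 2) ^ (2 : ℝ) * μ {x | s / 2 < |Tg x|} ≤ (A : ℝ≥0∞) ^ (2 : ℝ) * ∫⁻ x, ‖g x‖ₑ ^ (2 : ℝ) ∂μ := by
      have h := weakType_of_eLpNorm_le (μ := μ) (ν := μ) (f := g) (g := Tg) (q := 2) two_ne_zero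
        ENNReal.ofNat_ne_top hTg_meas (hL2 g hgm hgb hgc) (s / 2)
      simpa only [ENNReal.toReal_ofNat, Real.norm_eq_abs] using h
    -- `∫ |g|² ≤ 4ⁿ s ‖g‖₁ ≤ 4ⁿ s ‖f‖₁`
    have hg2 : ∫⁻ x, ‖g x‖ₑ ^ (2 : ℝ) ∂μ ≤ ENNReal.ofReal (4 ^ n * s) * L := by
      calc ∫⁻ x, ‖g x‖ₑ ^ (2 : ℝ) ∂μ ≤ ∫⁻ x, ENNReal.ofReal (4 ^ n * s) * ‖g x‖ₑ ∂μ := by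
            refine lintegral_mono_ae ?_
            filter_upwards [hg_ae] with x hx
            rw [ENNReal.rpow_two, sq]
            gcongr
            rw [Real.enorm_eq_ofReal_abs]
            exact ENNReal.ofReal_le_ofReal hx
        _ = ENNReal.ofReal (4 ^ n * s) * ∫⁻ x, ‖g x‖ₑ ∂μ := lintegral_const_mul' _ _ ENNReal.ofReal_ne_top
        _ ≤ ENNReal.ofReal (4 ^ n * s) * L := by gcongr
    have hne : ENNReal.ofReal (s / 2) ^ (2 : ℝ) ≠ 0 :=
      (ENNReal.rpow_pos (ENNReal.ofReal_pos.2 hs2) ENNReal.ofReal_ne_top).ne'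
    have hne' : ENNReal.ofReal (s / 2) ^ (2 : ℝ) ≠ ⊤ := ENNReal.rpow_ne_top_of_nonneg zero_le_two ENNReal.ofReal_ne_top
    have hμ : μ {x | s / 2 < |Tg x|} ≤ (ENNReal.ofReal (s / 2) ^ (2 : ℝ))⁻¹ * ((A : ℝ≥0∞) ^ (2 : ℝ) * (ENNReal.ofReal (4 ^ n * s) * L)) := by
      rw [← ENNReal.mul_le_iff_le_inv hne hne']
      exact hcheb.trans (mul_le_mul' le_rfl hg2)
    -- the scalar identity `s (s/2)⁻² 4ⁿ s = 4ⁿ⁺¹`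
    have hscal : ENNReal.ofReal s * ((ENNReal.ofReal (s / 2) ^ (2 : ℝ))⁻¹ * ENNReal.ofReal (4 ^ n * s)) = 4 ^ (n + 1) := by
      rw [ENNReal.ofReal_rpow_of_pos hs2, ← ENNReal.ofReal_inv_of_pos (by positivity),
        ← ENNReal.ofReal_mul (by positivity), ← ENNReal.ofReal_mul hs.le]
      rw [show s * (((s / 2) ^ (2 : ℝ))⁻¹ * (4 ^ n * s)) = (4 : ℝ) ^ (n + 1) by
        rw [Real.rpow_two]; field_simp; ring]
      rw [ENNReal.ofReal_pow (by norm_num), ENNReal.ofReal_ofNat]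
    calc ENNReal.ofReal s * μ {x | s / 2 < |Tg x|}
        ≤ ENNReal.ofReal s * ((ENNReal.ofReal (s / 2) ^ (2 : ℝ))⁻¹ * ((A : ℝ≥0∞) ^ (2 : ℝ) * (ENNReal.ofReal (4 ^ n * s) * L))) := by
          gcongr
      _ = ENNReal.ofReal s * ((ENNReal.ofReal (s / 2) ^ (2 : ℝ))⁻¹ * ENNReal.ofReal (4 ^ n * s)) * (A : ℝ≥0∞) ^ (2 : ℝ) * L := by
          ring
      _ = 4 ^ (n + 1) * (A : ℝ≥0∞) ^ 2 * L := by rw [hscal, ENNReal.rpow_two]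
  /- Step 3: the exceptional set `Ω* = ⋃ B̄(cᵢ, 8rᵢ)`, `s μ(Ω*) ≤ 8ⁿ ‖f‖₁` -/
  set Ωs : Set E := ⋃ i, closedBall (c i) (8 * r i) with hΩs
  have hΩs_meas : MeasurableSet Ωs := MeasurableSet.iUnion fun i => measurableSet_closedBall
  have hexc : ENNReal.ofReal s * μ Ωs ≤ 8 ^ n * L := by
    have h8 : ∀ i, μ (closedBall (c i) (8 * r i)) = ENNReal.ofReal ((8 : ℝ) ^ n) * μ (closedBall (c i) (r i)) :=
      fun i => measure_closedBall_mul μ (c i) (by norm_num) (hr i).le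
    calc ENNReal.ofReal s * μ Ωs ≤ ENNReal.ofReal s * ∑' i, μ (closedBall (c i) (8 * r i)) := by
          gcongr; exact measure_iUnion_le _
      _ = ENNReal.ofReal s * (ENNReal.ofReal ((8 : ℝ) ^ n) * ∑' i, μ (closedBall (c i) (r i))) := by
          congr 1
          rw [← ENNReal.tsum_mul_left]
          exact tsum_congr h8
      _ ≤ ENNReal.ofReal s * (ENNReal.ofReal ((8 : ℝ) ^ n) * ((ENNReal.ofReal s)⁻¹ * L)) := by gcongr
      _ = ENNReal.ofReal ((8 : ℝ) ^ n) * (ENNReal.ofReal s * (ENNReal.ofReal s)⁻¹) * L := by ring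
      _ = 8 ^ n * L := by
          rw [ENNReal.mul_inv_cancel (ENNReal.ofReal_pos.2 hs).ne' ENNReal.ofReal_ne_top, mul_one,
            ENNReal.ofReal_pow (by norm_num), ENNReal.ofReal_ofNat]
  /- Step 4: the bad part off `Ω*`: `∫_{Ω*ᶜ} |Tb| ≤ 2B ‖f‖₁` -/
  have hbad_int : ∫⁻ x in Ωsᶜ, ‖Tb x‖ₑ ∂μ ≤ 2 * B * L := by
    calc ∫⁻ x in Ωsᶜ, ‖Tb x‖ₑ ∂μ ≤ ∫⁻ x in Ωsᶜ, ∑' i, ‖Tbi i x‖ₑ ∂μ := by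
          refine lintegral_mono fun x => ?_
          rw [hTb_tsum x]
          exact enorm_tsum_le_tsum_enorm
      _ = ∑' i, ∫⁻ x in Ωsᶜ, ‖Tbi i x‖ₑ ∂μ :=
          lintegral_tsum fun i => (hTbi_meas i).enorm.aemeasurable
      _ ≤ ∑' i, ∫⁻ x in (closedBall (c i) (8 * r i))ᶜ, ‖Tbi i x‖ₑ ∂μ := by
          refine ENNReal.tsum_le_tsum fun i => lintegral_mono_set (compl_subset_compl.2 ?_)
          exact subset_iUnion (fun i => closedBall (c i) (8 * r i)) i
      _ ≤ ∑' i, (B : ℝ≥0∞) * ∫⁻ t, ‖b i t‖ₑ ∂μ :=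
          ENNReal.tsum_le_tsum fun i => lintegral_compl_ball_integral_mul_kernel_le hk hM hH (hbm i) (hbi i)
            (hbsupp i) (hbmean i)
      _ = B * ∑' i, ∫⁻ t, ‖b i t‖ₑ ∂μ := ENNReal.tsum_mul_left
      _ ≤ B * (2 * L) := by gcongr
      _ = 2 * B * L := by ring
  have hbad : ENNReal.ofReal s * μ {x | s / 2 < |Tb x|} ≤ (8 ^ n + 4 * B) * L := by
    have hs2 : 0 < s / 2 := by positivity
    -- Chebyshev on `Ω*ᶜ`
    have hmarkov : ENNReal.ofReal (s / 2) * μ ({x | s / 2 < |Tb x|} ∩ Ωsᶜ) ≤ 2 * B * L := by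
      calc ENNReal.ofReal (s / 2) * μ ({x | s / 2 < |Tb x|} ∩ Ωsᶜ)
          ≤ ENNReal.ofReal (s / 2) * (μ.restrict Ωsᶜ) {x | ENNReal.ofReal (s / 2) ≤ ‖Tb x‖ₑ} := by
            rw [Measure.restrict_apply' hΩs_meas.compl]
            refine mul_le_mul' le_rfl (measure_mono ?_)
            rintro x ⟨hx, hxΩ⟩
            refine ⟨?_, hxΩ⟩
            show ENNReal.ofReal (s / 2) ≤ ‖Tb x‖ₑ
            rw [Real.enorm_eq_ofReal_abs]
            exact ENNReal.ofReal_le_ofReal (le_of_lt hx)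
        _ ≤ ∫⁻ x in Ωsᶜ, ‖Tb x‖ₑ ∂μ := mul_meas_ge_le_lintegral₀ hTb_meas.enorm.aemeasurable _
        _ ≤ 2 * B * L := hbad_int
    have h2 : ENNReal.ofReal s = 2 * ENNReal.ofReal (s / 2) := by
      rw [← ENNReal.ofReal_ofNat 2, ← ENNReal.ofReal_mul (by norm_num)]
      congr 1; ring
    calc ENNReal.ofReal s * μ {x | s / 2 < |Tb x|}
        ≤ ENNReal.ofReal s * (μ ({x | s / 2 < |Tb x|} ∩ Ωs) + μ ({x | s / 2 < |Tb x|} ∩ Ωsᶜ)) := by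
          gcongr
          calc μ {x | s / 2 < |Tb x|}
              ≤ μ (({x | s / 2 < |Tb x|} ∩ Ωs) ∪ ({x | s / 2 < |Tb x|} ∩ Ωsᶜ)) := by
                refine measure_mono fun x hx => ?_
                by_cases hxΩ : x ∈ Ωs
                · exact Or.inl ⟨hx, hxΩ⟩
                · exact Or.inr ⟨hx, hxΩ⟩
            _ ≤ _ := measure_union_le _ _
      _ ≤ ENNReal.ofReal s * μ Ωs + ENNReal.ofReal s * μ ({x | s / 2 < |Tb x|} ∩ Ωsᶜ) := by
          rw [mul_add]
          gcongr
          exact inter_subset_right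
      _ ≤ 8 ^ n * L + 2 * (2 * B * L) := by
          refine add_le_add hexc ?_
          rw [h2, mul_assoc]
          gcongr
      _ = (8 ^ n + 4 * B) * L := by ring
  /- conclusion -/
  calc ENNReal.ofReal s * μ {x | s < |Tf x|}
      ≤ ENNReal.ofReal s * (μ {x | s / 2 < |Tg x|} + μ {x | s / 2 < |Tb x|}) := by gcongr
    _ = ENNReal.ofReal s * μ {x | s / 2 < |Tg x|} + ENNReal.ofReal s * μ {x | s / 2 < |Tb x|} := mul_add _ _ _
    _ ≤ 4 ^ (n + 1) * (A : ℝ≥0∞) ^ 2 * L + (8 ^ n + 4 * B) * L := add_le_add hgood hbad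
    _ = (4 ^ (n + 1) * (A : ℝ≥0∞) ^ 2 + 8 ^ n + 4 * B) * L := by ring

end Literature.Analysis.SingularIntegrals
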